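import Summits.AtomisticToContinuum.HydrodynamicLimit.Theorems.TwoClocksTransferEntropyClockEquilibriumFamilyStatics
import Summits.AtomisticToContinuum.HydrodynamicLimit.Theorems.EnskogAdjointDualityDualityReductionMaxwellian
import HarnessLib

/-!
# Equilibrium family node from the pointwise kinetic node, layer 3: admissible profiles, Baire, orthogonality transfer

Crux `Summit.AtomisticToContinuum.HydrodynamicLimit.Theses.TwoClocks.TransferEntropyClock` (stmt-AtomisticToContinuum-16625),
line `Sketch`, registered stub S3a `stub_equilibriumFamily : EquilibriumFamilyUpgrade`
(`= WindowUpgrade → TwoClocks.KineticWindowLDUniform → EquilibriumKineticLDFamily`): THE POINTWISE KINETIC DOCKING NODE IS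
SECRETLY FAMILY-UNIFORM AT GLOBAL EQUILIBRIUM — along one-parameter families of CONSTANT profiles `(a(s), θ(s), u(s))` and
x-independent weights at one fixed reduced density `σ`, the window-LD bound holds with a tilt radius `β₀` and, per `(β, ε)`,
thresholds `τ₀, N₀` UNIFORM in the family parameter. Proof files (lead prover-line-stmt-AtomisticToContinuum-16625-0):
`…EquilibriumFamilyFrame` (this chain's layer 1: exact frame reduction + Gaussian tail statics), `…EquilibriumFamilyStatics`
(layer 2: the property `Good`, midpoint convexity, closed radius super-level sets), `…EquilibriumFamilyBaire` (layer 3: the Banach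
space of admissible profiles, the Baire uniform-radius theorem, orthogonality transfer), `…EquilibriumFamily` (layer 4: the stub).

THIS FILE. (1) The Banach space `admissible` of profiles `f` whose weighted functional `(1+‖v‖²) f` is Maxwellian-orthogonal to
the collision invariants `1, v_j, ‖v‖²` (a closed subspace of `V3 →ᵇ ℝ`, intersection of kernels of five continuous linear
functionals `pairingCLM`; complete). (2) The abstract BAIRE lemma `uniform_radius_of_baire` (a midpoint-convex, everywhere
absorbing property with closed radius super-level sets of a real Banach space holds at `t • x` whenever `|t| ‖x‖ < c`) and its
application `uniform_good_of_pointwise`: ONE tilt-radius constant for all admissible profiles at a fixed `(σ, Φ)`. (3) The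
orthogonality transfer `ortho_frame` to the unit frame under `v = √θ w + u` (the collision invariants span an affine-invariant
space; Maxwellian change of variables through `gaussMeasure`).
-/

noncomputable section

open MeasureTheory Filter Set Topology Function
open scoped ENNReal
open Literature.MathematicalPhysics.KineticTheory Literature.Analysis.FluidPDE
open Summit.AtomisticToContinuum.HydrodynamicLimit.Theorems.KineticWindowGronwallBoost
open Summit.AtomisticToContinuum.HydrodynamicLimit.Theorems.KineticWindowGronwallThermalScaling
open Summit.AtomisticToContinuum.HydrodynamicLimit.Theorems.KineticWindowGronwallFrame
open Summit.AtomisticToContinuum.HydrodynamicLimit.Theorems.KineticWindowGronwallNegative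

namespace Summit.AtomisticToContinuum.HydrodynamicLimit.Theorems.TransferEntropyClockFrame

/-! ## The Banach space of admissible velocity profiles

A fast one-body functional of quadratic growth is `F(v) = (1 + ‖v‖²) f(v)` with `f` bounded continuous; admissibility
(orthogonality to the collision invariants `1, v_j, ‖v‖²` under the unit Maxwellian `M_{1,0,1}`) is membership of `f`
in the closed subspace `admissible` of `V3 →ᵇ ℝ` cut out by five continuous linear functionals. -/

section Admissible

/-- The Maxwellian pairing of the weighted profile with a velocity polynomial `p`, in the literal shape of the
orthogonality hypotheses of the kinetic nodes: `f ↦ ∫ (1 + ‖v‖²) f(v) p(v) M_{1,0,1}(v) dv`. -/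
def pairing (p : V3 → ℝ) (f : BoundedContinuousFunction V3 ℝ) : ℝ :=
  ∫ v, (1 + ‖v‖ ^ 2) * f v * p v * localMaxwellian 1 1 (0 : V3) v

/-- A velocity weight of quadratic growth: continuous with `|p v| (1 + ‖v‖²) ≤ (1 + ‖v‖²)²`. -/
def IsQuadWeight (p : V3 → ℝ) : Prop :=
  Continuous p ∧ ∀ v : V3, |p v| ≤ 1 + ‖v‖ ^ 2

/-- The integrand of the pairing is dominated by `‖f‖ (1 + ‖v‖²)²`. [folklore] -/
theorem abs_pairing_integrand_le {p : V3 → ℝ} (hp : IsQuadWeight p) (f : BoundedContinuousFunction V3 ℝ) (v : V3) :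
    |(1 + ‖v‖ ^ 2) * f v * p v| ≤ ‖f‖ * (1 + ‖v‖ ^ 2) ^ 2 := by
  have hw : 0 ≤ 1 + ‖v‖ ^ 2 := by positivity
  rw [abs_mul, abs_mul, abs_of_nonneg hw]
  have hf : |f v| ≤ ‖f‖ := by simpa [Real.norm_eq_abs] using f.norm_coe_le_norm v
  calc (1 + ‖v‖ ^ 2) * |f v| * |p v| ≤ (1 + ‖v‖ ^ 2) * ‖f‖ * (1 + ‖v‖ ^ 2) := by
        gcongr
        exact hp.2 v
    _ = ‖f‖ * (1 + ‖v‖ ^ 2) ^ 2 := by ring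

/-- The pairing is absolutely convergent. [folklore] -/
theorem integrable_pairing {p : V3 → ℝ} (hp : IsQuadWeight p) (f : BoundedContinuousFunction V3 ℝ) :
    Integrable fun v : V3 => (1 + ‖v‖ ^ 2) * f v * p v * localMaxwellian 1 1 (0 : V3) v := by
  have hf : Continuous f := f.continuous
  have hm : AEStronglyMeasurable (fun v : V3 => (1 + ‖v‖ ^ 2) * f v * p v) volume := by
    have := hp.1; fun_prop
  have h := integrable_localMaxwellian_mul_of_abs_le one_pos (0 : V3) hm (abs_pairing_integrand_le hp f)
  refine h.congr (Filter.Eventually.of_forall fun v => ?_)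
  ring

/-- The pairing is bounded by `‖f‖` times the Gaussian fourth moment. [folklore] -/
theorem abs_pairing_le {p : V3 → ℝ} (hp : IsQuadWeight p) (f : BoundedContinuousFunction V3 ℝ) :
    |pairing p f| ≤ (∫ v, (1 + ‖v‖ ^ 2) ^ 2 ∂gaussMeasure (0 : V3) 1) * ‖f‖ := by
  have h := abs_integral_localMaxwellian_mul_le one_pos (0 : V3) (abs_pairing_integrand_le hp f)
  have heq : (∫ v, localMaxwellian 1 1 (0 : V3) v * ((1 + ‖v‖ ^ 2) * f v * p v)) = pairing p f := by
    unfold pairing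
    refine integral_congr_ae (Filter.Eventually.of_forall fun v => ?_)
    ring
  rw [heq] at h
  linarith [h]

/-- **The pairing as a continuous linear functional** on `V3 →ᵇ ℝ`. -/
def pairingCLM {p : V3 → ℝ} (hp : IsQuadWeight p) : (BoundedContinuousFunction V3 ℝ) →L[ℝ] ℝ :=
  LinearMap.mkContinuous
    { toFun := pairing p
      map_add' := fun f g => by
        unfold pairing
        rw [← integral_add (integrable_pairing hp f) (integrable_pairing hp g)]
        refine integral_congr_ae (Filter.Eventually.of_forall fun v => ?_)
        simp only [BoundedContinuousFunction.coe_add, Pi.add_apply]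
        ring
      map_smul' := fun c f => by
        unfold pairing
        rw [RingHom.id_apply, smul_eq_mul, ← integral_const_mul]
        refine integral_congr_ae (Filter.Eventually.of_forall fun v => ?_)
        simp only [BoundedContinuousFunction.coe_smul, smul_eq_mul]
        ring }
    (∫ v, (1 + ‖v‖ ^ 2) ^ 2 ∂gaussMeasure (0 : V3) 1)
    (fun f => by simpa [Real.norm_eq_abs] using abs_pairing_le hp f)

/-- Unfolding lemma. [folklore] -/
theorem pairingCLM_apply {p : V3 → ℝ} (hp : IsQuadWeight p) (f : BoundedContinuousFunction V3 ℝ) :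
    pairingCLM hp f = pairing p f := rfl

/-- The five weights: `1`, the coordinates, `‖v‖²`. [folklore] -/
theorem isQuadWeight_one : IsQuadWeight fun _ : V3 => (1 : ℝ) :=
  ⟨continuous_const, fun v => by rw [abs_one]; nlinarith [norm_nonneg v]⟩

/-- [folklore] -/
theorem isQuadWeight_coord (j : Fin 3) : IsQuadWeight fun v : V3 => v j := by
  refine ⟨(EuclideanSpace.proj j).continuous, fun v => ?_⟩
  have h : |v j| ≤ ‖v‖ := by simpa [Real.norm_eq_abs] using PiLp.norm_apply_le v j
  nlinarith [norm_nonneg v, abs_nonneg (v j)]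

/-- [folklore] -/
theorem isQuadWeight_normSq : IsQuadWeight fun v : V3 => ‖v‖ ^ 2 :=
  ⟨by fun_prop, fun v => by rw [abs_of_nonneg (sq_nonneg _)]; nlinarith [norm_nonneg v]⟩

/-- **The closed subspace of admissible profiles**: `(1 + ‖v‖²) f` is Maxwellian-orthogonal to `1, v_j, ‖v‖²`. -/
def admissible : Submodule ℝ (BoundedContinuousFunction V3 ℝ) :=
  LinearMap.ker (pairingCLM isQuadWeight_one).toLinearMap ⊓
    ((⨅ j : Fin 3, LinearMap.ker (pairingCLM (isQuadWeight_coord j)).toLinearMap) ⊓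
      LinearMap.ker (pairingCLM isQuadWeight_normSq).toLinearMap)

/-- Membership in `admissible`, in the literal shape of the orthogonality hypotheses of `KineticWindowLDUniform` at the
unit frame. [folklore] -/
theorem mem_admissible_iff (f : BoundedContinuousFunction V3 ℝ) :
    f ∈ admissible ↔
      (∫ v, (1 + ‖v‖ ^ 2) * f v * localMaxwellian 1 1 (0 : V3) v = 0) ∧
      (∀ j : Fin 3, ∫ v, (1 + ‖v‖ ^ 2) * f v * v j * localMaxwellian 1 1 (0 : V3) v = 0) ∧
      (∫ v, (1 + ‖v‖ ^ 2) * f v * ‖v‖ ^ 2 * localMaxwellian 1 1 (0 : V3) v = 0) := by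
  simp only [admissible, Submodule.mem_inf, Submodule.mem_iInf, LinearMap.mem_ker, ContinuousLinearMap.coe_coe,
    pairingCLM_apply, pairing, mul_one]

/-- `admissible` is closed. [folklore] -/
theorem isClosed_admissible : IsClosed (admissible : Set (BoundedContinuousFunction V3 ℝ)) := by
  have h1 := ContinuousLinearMap.isClosed_ker (pairingCLM isQuadWeight_one)
  have h2 : ∀ j : Fin 3, IsClosed (LinearMap.ker (pairingCLM (isQuadWeight_coord j)).toLinearMap :
      Set (BoundedContinuousFunction V3 ℝ)) := fun j => ContinuousLinearMap.isClosed_ker _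
  have h3 := ContinuousLinearMap.isClosed_ker (pairingCLM isQuadWeight_normSq)
  simp only [admissible, Submodule.coe_inf, Submodule.coe_iInf]
  exact h1.inter ((isClosed_iInter h2).inter h3)

/-- `admissible` is complete. [folklore] -/
instance completeSpace_admissible : CompleteSpace admissible :=
  isClosed_admissible.completeSpace_coe

end Admissible


/-! ## Uniform tilt radius by Baire category -/

section Baire

/-- **Uniform radius by Baire.** In a real Banach space, a midpoint-convex property that every line through the
origin enjoys on a neighbourhood of `0` (pointwise positive radius) and whose radius super-level sets
`{x | ∀ |t| < c, good (t • x)}` are closed, holds at `t • x` whenever `|t| ‖x‖ < c` for one `c > 0`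
(the radius is `≥ c / ‖x‖`). [folklore] -/
theorem uniform_radius_of_baire {E : Type*} [NormedAddCommGroup E] [NormedSpace ℝ E] [CompleteSpace E]
    (good : E → Prop)
    (h_mid : ∀ x y, good x → good y → good ((2 : ℝ)⁻¹ • (x + y)))
    (h_abs : ∀ x, ∃ r : ℝ, 0 < r ∧ ∀ t : ℝ, |t| < r → good (t • x))
    (h_closed : ∀ c : ℝ, IsClosed {x : E | ∀ t : ℝ, |t| < c → good (t • x)}) :
    ∃ c : ℝ, 0 < c ∧ ∀ (x : E) (t : ℝ), |t| * ‖x‖ < c → good (t • x) := by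
  -- the closed cover by radius super-level sets
  set A : ℕ → Set E := fun m => {x : E | ∀ t : ℝ, |t| < 1 / ((m : ℝ) + 1) → good (t • x)} with hA
  have hAc : ∀ m, IsClosed (A m) := fun m => h_closed _
  have hAU : ⋃ m, A m = univ := by
    refine eq_univ_of_forall fun x => ?_
    obtain ⟨r, hr, hx⟩ := h_abs x
    obtain ⟨m, hm⟩ := exists_nat_one_div_lt hr
    exact mem_iUnion.2 ⟨m, fun t ht => hx t (ht.trans hm)⟩
  -- Baire: one of them has interior, hence contains a ball
  obtain ⟨m, x₀, hx₀⟩ := nonempty_interior_of_iUnion_of_closed hAc hAU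
  obtain ⟨δ₀, hδ₀, hball⟩ := Metric.mem_nhds_iff.1 (mem_interior_iff_mem_nhds.1 hx₀)
  -- midpoint convexity moves the ball to the origin
  have hkey : ∀ h : E, ‖h‖ < δ₀ → ∀ t : ℝ, |t| < 1 / ((m : ℝ) + 1) → good (t • h) := by
    intro h hh t ht
    have h₁ : x₀ + h ∈ A m := hball (by rw [Metric.mem_ball, dist_eq_norm, add_sub_cancel_left]; exact hh)
    have h₂ : x₀ - h ∈ A m := hball (by
      rw [Metric.mem_ball, dist_eq_norm, sub_sub_cancel_left, norm_neg]; exact hh)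
    have g₁ : good (t • (x₀ + h)) := h₁ t ht
    have g₂ : good ((-t) • (x₀ - h)) := h₂ (-t) (by rwa [abs_neg])
    have hmid := h_mid _ _ g₁ g₂
    have heq : (2 : ℝ)⁻¹ • (t • (x₀ + h) + (-t) • (x₀ - h)) = t • h := by
      have h2 : t • (x₀ + h) + (-t) • (x₀ - h) = (2 : ℝ) • (t • h) := by
        rw [two_smul, smul_add, neg_smul, smul_sub]
        abel
      rw [h2, smul_smul, inv_mul_cancel₀ two_ne_zero, one_smul]
    rwa [heq] at hmid
  -- homogeneity of the radius
  refine ⟨δ₀ / (2 * ((m : ℝ) + 1)), by positivity, fun x t hxt => ?_⟩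
  have hm0 : (0 : ℝ) < (m : ℝ) + 1 := by positivity
  by_cases hx : x = 0
  · subst hx
    have h0 := hkey 0 (by rwa [norm_zero]) 0 (by rw [abs_zero]; positivity)
    rwa [smul_zero, ← smul_zero t] at h0
  · have hxn : 0 < ‖x‖ := norm_pos_iff.2 hx
    have hc0 : 0 < δ₀ / (2 * ‖x‖) := div_pos hδ₀ (mul_pos two_pos hxn)
    set h : E := (δ₀ / (2 * ‖x‖)) • x with hh
    have hhn : ‖h‖ < δ₀ := by
      have : ‖h‖ = δ₀ / 2 := by
        rw [hh, norm_smul, Real.norm_eq_abs, abs_of_pos hc0]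
        field_simp
      rw [this]
      linarith
    set t' : ℝ := t * (2 * ‖x‖ / δ₀) with ht'
    have ht'x : t' • h = t • x := by
      rw [hh, ht', smul_smul]
      congr 1
      field_simp
    have hpos : 0 < 2 * ‖x‖ / δ₀ := div_pos (mul_pos two_pos hxn) hδ₀
    have ht'lt : |t'| < 1 / ((m : ℝ) + 1) := by
      have habs : |t'| = |t| * (2 * ‖x‖ / δ₀) := by rw [ht', abs_mul, abs_of_pos hpos]
      rw [habs, lt_div_iff₀ hm0]
      rw [lt_div_iff₀ (by positivity)] at hxt
      have : |t| * (2 * ‖x‖ / δ₀) * ((m : ℝ) + 1) = |t| * ‖x‖ * (2 * ((m : ℝ) + 1)) / δ₀ := by ring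
      rw [this, div_lt_one hδ₀]
      exact hxt
    rw [← ht'x]
    exact hkey h hhn t' ht'lt


variable (σ : ℝ) (Φ : (N : ℕ) → TFlow σ N)

/-- **UNIFORM RADIUS FOR ADMISSIBLE PROFILES.** If every admissible profile is good on a neighbourhood of tilt `0`
(the pointwise kinetic node at the unit frame, upgraded to all long windows), then there is ONE `c > 0` with
`Good σ Φ (t • f)` for every admissible `f` and every tilt with `|t| ‖f‖ < c` (Baire on the Banach space
`admissible`, midpoint convexity `Good.midpoint`, closed radius super-level sets `isClosed_goodRadius`). [folklore] -/
theorem uniform_good_of_pointwise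
    (HP : ∀ f : BoundedContinuousFunction V3 ℝ, f ∈ admissible →
      ∃ r : ℝ, 0 < r ∧ ∀ t : ℝ, |t| < r → Good σ Φ (t • f)) :
    ∃ c : ℝ, 0 < c ∧ ∀ f : BoundedContinuousFunction V3 ℝ, f ∈ admissible →
      ∀ t : ℝ, |t| * ‖f‖ < c → Good σ Φ (t • f) := by
  obtain ⟨c, hc, h⟩ := uniform_radius_of_baire (E := admissible) (fun x => Good σ Φ (x : BoundedContinuousFunction V3 ℝ))
    (fun x y hx hy => by
      have hm := Good.midpoint hx hy
      simpa only [Submodule.coe_smul, Submodule.coe_add] using hm)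
    (fun x => by
      obtain ⟨r, hr, hx⟩ := HP x x.2
      refine ⟨r, hr, fun t ht => ?_⟩
      have h1 := hx t ht
      rwa [← Submodule.coe_smul] at h1)
    (fun c => by
      have hset : {x : admissible | ∀ t : ℝ, |t| < c → Good σ Φ ((t • x : admissible) : BoundedContinuousFunction V3 ℝ)} =
          Subtype.val ⁻¹' {f : BoundedContinuousFunction V3 ℝ | ∀ t : ℝ, |t| < c → Good σ Φ (t • f)} := by
        ext x
        simp only [Set.mem_setOf_eq, Set.mem_preimage, Submodule.coe_smul]
      rw [hset]
      exact (isClosed_goodRadius c).preimage continuous_subtype_val)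
  refine ⟨c, hc, fun f hf t ht => ?_⟩
  have h' := h ⟨f, hf⟩ t (by simpa using ht)
  simpa only [Submodule.coe_smul] using h'

end Baire


/-! ## Orthogonality transfer to the unit frame -/

section Ortho

/-- **Maxwellian change of variables** `v = √θ w + u`: `∫ g(v) p(v) M_{1,u,θ}(v) dv = ∫ g(√θ w + u) p(√θ w + u) M_{1,0,1}(w) dw`
(both sides are `∫ (g p)(u + √θ w) dN(0, id)`; no integrability needed). [folklore] -/
theorem integral_mul_localMaxwellian_frame {θ : ℝ} (hθ : 0 < θ) (u : V3) (g p : V3 → ℝ) :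
    ∫ v, g v * p v * localMaxwellian 1 θ u v =
      ∫ w, g (Real.sqrt θ • w + u) * p (Real.sqrt θ • w + u) * localMaxwellian 1 1 (0 : V3) w := by
  have h1 : ∫ v, g v * p v * localMaxwellian 1 θ u v = ∫ v, localMaxwellian 1 θ u v * (g v * p v) :=
    integral_congr_ae (Filter.Eventually.of_forall fun v => by ring)
  have h2 : ∫ w, g (Real.sqrt θ • w + u) * p (Real.sqrt θ • w + u) * localMaxwellian 1 1 (0 : V3) w =
      ∫ w, localMaxwellian 1 1 (0 : V3) w * (g (Real.sqrt θ • w + u) * p (Real.sqrt θ • w + u)) :=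
    integral_congr_ae (Filter.Eventually.of_forall fun v => by ring)
  rw [h1, h2, integral_localMaxwellian_mul_eq_integral_gaussMeasure hθ,
    integral_localMaxwellian_mul_eq_integral_gaussMeasure one_pos, integral_gaussMeasure u hθ,
    integral_gaussMeasure (0 : V3) one_pos]
  refine integral_congr_ae (Filter.Eventually.of_forall fun w => ?_)
  simp only [Real.sqrt_one, one_smul, zero_add, add_comm u]

/-- Coordinates of `√θ w + u`. [folklore] -/
theorem coord_frame (θ : ℝ) (u w : V3) (j : Fin 3) : (Real.sqrt θ • w + u) j = Real.sqrt θ * w j + u j := by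
  simp [PiLp.add_apply, PiLp.smul_apply, smul_eq_mul]

/-- `‖√θ w‖² = θ ‖w‖²` for `θ ≥ 0`. [folklore] -/
theorem norm_sqrt_smul_sq {θ : ℝ} (hθ : 0 ≤ θ) (w : V3) : ‖Real.sqrt θ • w‖ ^ 2 = θ * ‖w‖ ^ 2 := by
  rw [norm_smul, mul_pow, Real.norm_eq_abs, abs_of_nonneg (Real.sqrt_nonneg _), Real.sq_sqrt hθ]

/-- `‖v − u‖²` in coordinates: `‖v‖² − 2 Σ_j u_j v_j + ‖u‖²`. [folklore] -/
theorem norm_sub_sq_coord (v u : V3) : ‖v - u‖ ^ 2 = ‖v‖ ^ 2 - 2 * ∑ j : Fin 3, u j * v j + ‖u‖ ^ 2 := by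
  rw [norm_sub_sq_real]
  have h : inner ℝ v u = ∑ j : Fin 3, u j * v j := by
    rw [PiLp.inner_apply]
    refine Finset.sum_congr rfl fun j _ => ?_
    simp [mul_comm]
  rw [h]

/-- **Admissibility transfers to the unit frame.** If `F : V3 → ℝ` of quadratic growth is `M_{1,u,θ}`-orthogonal to
`1, v_j, ‖v‖²`, then `w ↦ F(√θ w + u)` is `M_{1,0,1}`-orthogonal to `1, w_j, ‖w‖²` (the collision invariants span an
affine-invariant space). [folklore] -/
theorem ortho_frame {θ : ℝ} (hθ : 0 < θ) (u : V3) {F : V3 → ℝ} (hF : Continuous F) {C : ℝ}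
    (hC : ∀ v, |F v| ≤ C * (1 + ‖v‖ ^ 2))
    (h1 : ∫ v, F v * localMaxwellian 1 θ u v = 0)
    (hv : ∀ j : Fin 3, ∫ v, F v * v j * localMaxwellian 1 θ u v = 0)
    (hvv : ∫ v, F v * ‖v‖ ^ 2 * localMaxwellian 1 θ u v = 0) :
    (∫ w, F (Real.sqrt θ • w + u) * localMaxwellian 1 1 (0 : V3) w = 0) ∧
    (∀ j : Fin 3, ∫ w, F (Real.sqrt θ • w + u) * w j * localMaxwellian 1 1 (0 : V3) w = 0) ∧
    (∫ w, F (Real.sqrt θ • w + u) * ‖w‖ ^ 2 * localMaxwellian 1 1 (0 : V3) w = 0) := by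
  have hrt : 0 < Real.sqrt θ := Real.sqrt_pos.2 hθ
  have hC0 : 0 ≤ C := by
    have h := hC 0
    have : (0 : ℝ) < 1 + ‖(0 : V3)‖ ^ 2 := by positivity
    nlinarith [abs_nonneg (F 0)]
  -- integrability of the three pairings in the `(θ, u)` frame
  have hint : ∀ {p : V3 → ℝ}, Continuous p → (∀ v, |p v| ≤ 1 + ‖v‖ ^ 2) →
      Integrable fun v => F v * p v * localMaxwellian 1 θ u v := by
    intro p hp hpb
    have hm : AEStronglyMeasurable (fun v => F v * p v) volume := by fun_prop
    have hb : ∀ v, |F v * p v| ≤ C * (1 + ‖v‖ ^ 2) ^ 2 := by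
      intro v
      rw [abs_mul]
      calc |F v| * |p v| ≤ C * (1 + ‖v‖ ^ 2) * (1 + ‖v‖ ^ 2) :=
            mul_le_mul (hC v) (hpb v) (abs_nonneg _) (by positivity)
        _ = C * (1 + ‖v‖ ^ 2) ^ 2 := by ring
    have h := integrable_localMaxwellian_mul_of_abs_le hθ u hm hb
    exact h.congr (Filter.Eventually.of_forall fun v => by ring)
  have hI1 : Integrable fun v => F v * localMaxwellian 1 θ u v := by
    have h := hint (p := fun _ => (1 : ℝ)) continuous_const (fun v => by rw [abs_one]; nlinarith [norm_nonneg v])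
    exact h.congr (Filter.Eventually.of_forall fun v => by simp)
  have hIv : ∀ j : Fin 3, Integrable fun v => F v * v j * localMaxwellian 1 θ u v := fun j =>
    hint (EuclideanSpace.proj j).continuous fun v => by
      have h : |v j| ≤ ‖v‖ := by simpa [Real.norm_eq_abs] using PiLp.norm_apply_le v j
      nlinarith [norm_nonneg v, abs_nonneg (v j)]
  refine ⟨?_, fun j => ?_, ?_⟩
  · -- `1`
    have h := integral_mul_localMaxwellian_frame hθ u F (fun _ => (1 : ℝ))
    simp only [mul_one] at h
    rw [← h]
    exact h1
  · -- `w_j = ((√θ w + u)_j − u_j)/√θ`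
    have h := integral_mul_localMaxwellian_frame hθ u F (fun v => (v j - u j) / Real.sqrt θ)
    have hR : ∀ w : V3, ((Real.sqrt θ • w + u) j - u j) / Real.sqrt θ = w j := by
      intro w
      rw [coord_frame]
      field_simp
      ring
    simp only [hR] at h
    rw [← h]
    have hsplit : (fun v => F v * ((v j - u j) / Real.sqrt θ) * localMaxwellian 1 θ u v) =
        fun v => (Real.sqrt θ)⁻¹ * (F v * v j * localMaxwellian 1 θ u v) -
          (u j / Real.sqrt θ) * (F v * localMaxwellian 1 θ u v) := by
      funext v; field_simp
    rw [hsplit, integral_sub ((hIv j).const_mul _) (hI1.const_mul _), integral_const_mul, integral_const_mul,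
      hv j, h1, mul_zero, mul_zero, sub_zero]
  · -- `‖w‖² = ‖(√θ w + u) − u‖²/θ`
    have h := integral_mul_localMaxwellian_frame hθ u F (fun v => ‖v - u‖ ^ 2 / θ)
    have hR : ∀ w : V3, ‖(Real.sqrt θ • w + u) - u‖ ^ 2 / θ = ‖w‖ ^ 2 := by
      intro w
      rw [add_sub_cancel_right, norm_sqrt_smul_sq hθ.le, mul_div_cancel_left₀ _ hθ.ne']
    simp only [hR] at h
    rw [← h]
    have hsplit : (fun v => F v * (‖v - u‖ ^ 2 / θ) * localMaxwellian 1 θ u v) =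
        fun v => (θ⁻¹ * (F v * ‖v‖ ^ 2 * localMaxwellian 1 θ u v) -
          (2 / θ) * (∑ j : Fin 3, u j * (F v * v j * localMaxwellian 1 θ u v))) +
          (‖u‖ ^ 2 / θ) * (F v * localMaxwellian 1 θ u v) := by
      funext v
      have hs : ∑ j : Fin 3, u j * (F v * v j * localMaxwellian 1 θ u v) =
          (F v * localMaxwellian 1 θ u v) * ∑ j : Fin 3, u j * v j := by
        rw [Finset.mul_sum]
        exact Finset.sum_congr rfl fun j _ => by ring
      rw [hs, norm_sub_sq_coord]
      field_simp
    have hIs : Integrable fun v => ∑ j : Fin 3, u j * (F v * v j * localMaxwellian 1 θ u v) :=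
      integrable_finsetSum _ fun j _ => (hIv j).const_mul _
    have hIvv : Integrable fun v => F v * ‖v‖ ^ 2 * localMaxwellian 1 θ u v :=
      hint (by fun_prop) fun v => by rw [abs_of_nonneg (sq_nonneg _)]; nlinarith [norm_nonneg v]
    have hA : Integrable fun v => θ⁻¹ * (F v * ‖v‖ ^ 2 * localMaxwellian 1 θ u v) := hIvv.const_mul _
    have hB : Integrable fun v => (2 / θ) * (∑ j : Fin 3, u j * (F v * v j * localMaxwellian 1 θ u v)) :=
      hIs.const_mul _
    have hCc : Integrable fun v => (‖u‖ ^ 2 / θ) * (F v * localMaxwellian 1 θ u v) := hI1.const_mul _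
    have hAB : Integrable fun v => θ⁻¹ * (F v * ‖v‖ ^ 2 * localMaxwellian 1 θ u v) -
        (2 / θ) * (∑ j : Fin 3, u j * (F v * v j * localMaxwellian 1 θ u v)) := hA.sub hB
    rw [hsplit, integral_add hAB hCc, integral_sub hA hB, integral_const_mul, integral_const_mul, integral_const_mul,
      integral_finsetSum _ (fun j _ => (hIv j).const_mul _)]
    simp only [integral_const_mul, hv, hvv, h1, mul_zero, Finset.sum_const_zero, sub_zero, add_zero]

end Ortho


end Summit.AtomisticToContinuum.HydrodynamicLimit.Theorems.TransferEntropyClockFrame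

end
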